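import Literature.MathematicalPhysics.QuantumFieldTheory.Balaban1983to89.B9GradViaDivLettersAtPinsHolderPairs

/-!
# `Balaban1983to89.B9GradViaDivLettersAtPinsHolder` — [B9] (3.3) p. 390 ∕ (3.40) p. 397 ∕ (3.44)–(3.45) p. 398 at node00-def-Y's letters: THE KINEMATIC LETTER
# `J_μ(U)` OF `D_U = Σ_μ ∇*_{U,μ} ∘ J_μ(U)` READ BETWEEN THE FLAT INPUT HÖLDER NORMS OF THE N06 CERTIFICATE, UNDER AN EXPLICIT SMALL-FIELD-GAUGE BINDER —
# the one interface on which the Hölder-source members of the D_U-orbit of rows 20–21 (`Letters313DZ.dgDH`, `Letters313DMZ.dgDHd`, `Letters313HZ.pYDH`,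
# `Thm33G0DivR.h44DsDv`) and n06-w6's `Thm33G0DirX.pXdDH` wait

T. Bałaban, *Propagators for lattice gauge theories in a background field*, Commun. Math. Phys. **99** (1985) 389–434
[`Balaban1985BackgroundPropagators`, "B9"]; [4] = T. Bałaban, *Propagators and renormalization transformations for lattice gauge
theories. II*, Commun. Math. Phys. **96** (1984) 223–250 [`Balaban1984PropagatorsII`].

statement-level skeleton of published theorems with citation tags; proofs where landed; nothing here is a claim about the Yang–Mills
mass gap

THE PRINTED LOCUS (held text `paper:balaban1985-cmp99-background-propagators`, pp. 396–398 read first-hand).  (3.40) p. 397: *"‖λ‖_β = max sup |R(U(Γ_{x,x′}))λ(x′)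
− λ(x)| ∕ |x − x′|^β … Γ_{x,x′} is a shortest contour connecting points x and x′"*; (3.44)–(3.45) p. 398 (input side `‖λ‖_ε + |λ|`, `‖λ‖_{α+ε} + |λ|`); p. 398:
*"All these inequalities are invariant with respect to gauge transformations of U"*; (3.35) p. 396: *"there exists a gauge transformation u on □ such that
U^u = e^{iηA}, and … |A| < O(1)Mα₀(Lʲη)⁻¹, |∇^ηA| < O(1)Mα₀(Lʲη)⁻²"*; (3.3) p. 390; [4] (2.137) p. 247, (2.51)–(2.52) p. 232, Lemma 2.1 (2.60) p. 234.

THE POINT.  `B9Thm313WholeDvFromDds` ∕ `B9Thm313WholeDvAtPins` (g17) turned the sup and block-L² members of the D_U-orbit of rows 20–21 into theorems through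
`D_U = Σ_μ ∇*_{U,μ} ∘ J_μ(U)` and the SUP letter of `J_μ` (p612121 `hasMaj_JcoKH`).  The HÖLDER-source members need `J_μ` between Hölder classes.  Print's
norms (3.40) TRANSPORT along `Γ_{x,x′}` and are gauge-invariant; the certificate's input classes (n06-d `bHS ∕ bHK`) are FLAT.  Between flat classes the Hölder
quotient of `J_μλ` acquires the TRANSPORT-VARIATION term `t^{−ε}‖U_μ(x) − U_μ(x′)‖·|λ|` (`…Pairs.abs_JcoKH_sub_le`), small exactly where the link field
varies little at the scale ξ — the content of the per-cube small-field gauge of (3.35) (node00-def-Y's word on «INPUT-HÖLDER-TRANSPORT», pub-ymgap bus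
2026-08-28: *"print TRANSPORTS … the flat holK is print's Hölder norm only in a gauge where sup ‖U(Γ_{x,x′}) − 1‖ over the Hölder window is small … keep holK flat,
but let the four Hölder-source members carry the explicit small-field-gauge binder"*).  THIS FILE types that reading with the binder EXPLICIT and MINIMAL:
  `hΘ : ∀ μ s s′, Adm ⟨s,μ⟩ ⟨s′,μ⟩ → t(⟨s,μ⟩,⟨s′,μ⟩)^{−ε}·‖U_μ(s) − U_μ(s′)‖ ≤ ϑ`
(the ξ-scale ε-Hölder datum of the link field over r03's admissible pairs; inside one cube's gauge (3.35) gives it with `ϑ = O((d+1)·cMα₀·L^{−j})`):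
* §1 ★ `holK_JcoKH_le` — the ξ-Hölder part of `J_μλ` on a class: `holK ε y (J_μλ) ≤ cR39·(2ϑ·supS y′ λ + 2·holS ε y′ λ)` (partner in the class: transport
  variation + shifted difference, `t^{−ε} ≤ wS`; partner outside: the jump, paid by `holS` at one of `{b₋, b′₋}`, weight ratio `2^ε·L^{(j−k)ε} ≤ 2`);
  ★★ `hasMaj_JcoKH_holder` — `HasMaj (bHS (sIK bI) ε) (bHK bI ε) (J_μ(U)) (2(1+ϑ)·cR39·e^{δ·rJ}·e^{−δd})`, every `δ ≥ 0`, `0 ≤ ε ≤ 1`, for `bI` 1-faithful and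
  direction-blind (the certificate's `hβ1`, `hbI0`) and contracting links;
* §2 the two consumer currencies: ★ `hasMaj_JcoKH_holder_weight` (both classes re-weighted by `len^γ`, `|γ| ≤ 4`; `γ = −1` is the 𝔥⁽¹⁾-type source of
  `dgDH ∕ dgDHd`) and ★ `hasMaj_JcoKH_holder_len` (source `weightNorm (bHS ε) len⁻¹`, target `bHK ε`, kernel `C_J·(Lʲη)(a)·e^{−δ_J d}` — the `hJ` shape of
  n06-w6's `B9Thm33G0DirXHolderFromDds`), both by [4] (2.60) under `Facts347`;
* §3 ★★ `hasMaj_JcoKH_holder_pins` — at def-Y's members (`Reg335` ⇒ contracting, p612121 `cfg_norm_le_one_of_reg335`), the binder `hΘ` a hypothesis on `U`.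

LOCATED (design, for the knit ∕ planners; recorded, not claimed as a defect of any landed file).  `hΘ` is a statement about `U` AS GIVEN: the flat classes are
gauge-VARIANT, and (3.35) supplies `hΘ` only inside ONE cube's gauge `u_□`; a `Reg335` configuration need not admit a global gauge in which `hΘ` is small (a
flat connection with non-trivial holonomy along a torus cycle is regular on every cube).  So under this reading the Hölder-source members hold for
configurations in small-gauge position; the gauge-invariant alternative re-types the input classes with def-Y's transporters (`parSymY ∕ parBY`) inside
`holS ∕ holK` (`bH : Cfg → ℝ → BlockNorm`), where `J_μ` needs no binder (transport commutes with the shift up to one plaquette holonomy per step) — the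
certificate owner's call.

HONEST SCOPE.  Instance-side bookkeeping + one elementary estimate; the smallness `ϑ` is a HYPOTHESIS on `U` (the cell's model letter, as the pub-balaban cell's
`B9Eq342GradientRowSmallGaugeLetters` «global small gauge»), NOT derived from `Reg335`; nothing of [B9]'s propagator estimates asserted; COUNT-NEUTRAL; N06 NOT
discharged; one finite lattice at a time; nothing continuum, nothing about the mass gap.  Cell `pub-ymgap` (HUMAN RULING D-0062), Track A node N06 [B9], rows
20–21 (bundle F7), seat `pub-ymgap-dag-n06-l` (g18), 2026-08-28.
-/

noncomputable section

namespace Literature.MathematicalPhysics.QuantumFieldTheory.Balaban1983to89.B9GradViaDivLettersAtPinsHolder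


open Node00 B6GlobalChartV1 B6KLevelCensusIndexV1 B9BackgroundsKLevelV1
open B9Eq39Adjoint (R R_zero R_neg R_inv_R R_add R_smul)
open Node00.OpsYNablaBridge (chartY shiftY_chartY chartY_eq)
open B9CoReadingCoords (XBK coordOpK assembleK blkBK)
open B9CoReadingCoordsH (coordOpKH coordOpKH_apply)
open B9CoReadingCoordsS (XSK blkSK sIK)
open B9CoReadingCoordsInput (restrK supK holK bHK supK_nonneg holK_nonneg holK_term_nonneg)
open B9CoReadingCoordsInputS (restrS supS holS bHS supS_nonneg holS_nonneg)
open B9CoReadingCoordsHolderS (wS wS_nonneg)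
open B9CoRealizesRelAtLetters (RelB relB_refl)
open LatticeFieldCalculus (supDist)
open B6Geom246MultiLevelTorus (geomT)
open B6Ineq2142KLevelV1 (β lvl)
open B9GeoNormsKLevelV1 (geo9K blkV1_level_le)
open B9Thm39ReadingCoords (cR39 cR39_nonneg coordBound39 basisBound39 abs_repr_le norm_sum_smul_basis_le)
open B9Thm34Ext (toB6)
open B9SectDSup (weightNorm)
open B11SectG (HasMaj BlockNorm)
open B9Thm312Whole (cNorm wt wt_nonneg GeoOK)
open B4TorusKernel.MultiPeriod (torusSupNorm)
open B6Prop22KLevelTorusCensusEta (nKT nKT_pos)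
open B9GradViaDivLettersAtPins (Jb Jb_apply JcoKH JcoKH_apply rJ dist_bI_sIK_shift_le supDist_shift_le_one abs_JcoKH_apply_le)

variable {𝔸 : Type} [NormedRing 𝔸] [NormedAlgebra ℂ 𝔸] [CompleteSpace 𝔸]
variable {d ℓ : ℕ} {hd : 1 ≤ d + 1} {hL : Odd (ℓ + 1) ∧ 1 < ℓ + 1} {b₀ b₁ : ℝ}
variable (i : KIdx d ℓ hd hL b₀ b₁)
variable {κ : Type} [Fintype κ]
open B9GradViaDivLettersAtPinsHolderPairs

/-! ## §1 ★★ The Hölder majorant of `J_μ(U)` between the flat input norms, under the small-field-gauge binder -/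

section Holder

variable (b : Module.Basis κ ℝ 𝔸) [FiniteDimensional ℝ 𝔸] (B : B9.Backgrounds) (cfg : B.Cfg → CfgY 𝔸 i)
variable [DecidableRel (RelB i)] {bI : FBondY i → IBondY i}

/-- ★ **THE ξ-HÖLDER PART OF `J_μλ` ON A CLASS**: for a `y′`-localized `λ`, direction-blind `bI`, contracting links with the ξ-scale ε-Hölder datum `ϑ`
(`t^{−ε}‖U_μ(s) − U_μ(s′)‖ ≤ ϑ` on admissible same-direction pairs), `0 ≤ ε ≤ 1`:
`holK ε y (J_μλ) ≤ cR39·(2ϑ·supS y′ λ + 2·holS ε y′ λ)` — per admissible pair based in the class of `y`: (A) partner in the class: transport variation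
`2ϑ·|λ|` + the shifted pair difference (`t^{−ε} ≤ wS`); (B) partner outside: the jump `|J_μλ(b)|`, paid by `holS` at a site among `{b₋, b′₋}` outside the class of
`y′` (weight ratio `≤ 2`); other directions and coincident points contribute `0`.
[cite: Balaban1985BackgroundPropagators, (3.3) p.390 + (3.35) p.396 + (3.40)–(3.41) p.397 + (3.44) p.398; Balaban1984PropagatorsII, (2.137) p.247] -/
theorem holK_JcoKH_le (hbI0 : ∀ f : FBondY i, bI f = bI ⟨f.src, 0⟩) {U₁ : B.Cfg}
    (hU : ∀ (ν : Fin (d + 1)) (s : Site (PV d ℓ i.m i.K hd hL) 0), ‖(cfg U₁ ν s : 𝔸)‖ ≤ 1 ∧ ‖(((cfg U₁ ν s)⁻¹ : 𝔸ˣ) : 𝔸)‖ ≤ 1)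
    {ε : ℝ} (hε : 0 ≤ ε) (hε1 : ε ≤ 1) {ϑ : ℝ} (hϑ : 0 ≤ ϑ)
    (hΘ : ∀ (μ : Fin (d + 1)) (s s' : Site (PV d ℓ i.m i.K hd hL) 0), Adm i ⟨s, μ⟩ ⟨s', μ⟩ →
      tpar i ⟨s, μ⟩ ⟨s', μ⟩ ^ (-ε) * ‖(cfg U₁ μ s : 𝔸) - (cfg U₁ μ s' : 𝔸)‖ ≤ ϑ)
    (μ : Fin (d + 1)) {y' : IBondY i} {lam : XSK κ i → ℝ} (hloc : ∀ p : XSK κ i, ¬ RelB i (sIK i bI p.1) y' → lam p = 0)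
    (y : IBondY i) :
    holK i bI ε y (JcoKH i b B cfg μ U₁ lam) ≤ cR39 b * (2 * ϑ * supS i (sIK i bI) y' lam + 2 * holS i (sIK i bI) ε y' lam) := by
  set J := JcoKH i b B cfg μ U₁ with hJ
  set S : ℝ := supS i (sIK i bI) y' lam with hS
  set H : ℝ := holS i (sIK i bI) ε y' lam with hH
  have hS0 : 0 ≤ S := supS_nonneg i _ y' lam
  have hH0 : 0 ≤ H := holS_nonneg i _ ε y' lam
  have hcR := cR39_nonneg b
  have hcb : 0 ≤ coordBound39 b := norm_nonneg _
  have hbb : 0 ≤ basisBound39 b := Finset.sum_nonneg fun _ _ => norm_nonneg _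
  have hM0 : 0 ≤ cR39 b * (2 * ϑ * S + 2 * H) := by positivity
  have hM1 : cR39 b * (2 * ϑ * S + H) ≤ cR39 b * (2 * ϑ * S + 2 * H) := mul_le_mul_of_nonneg_left (by linarith) hcR
  have hM2 : cR39 b * (2 * H) ≤ cR39 b * (2 * ϑ * S + 2 * H) := mul_le_mul_of_nonneg_left (by nlinarith) hcR
  refine Real.iSup_le (fun q => ?_) hM0
  obtain ⟨⟨⟨x, dx⟩, ⟨x', dx'⟩⟩, s⟩ := q
  dsimp only
  split_ifs with hq
  swap
  · exact hM0
  obtain ⟨hadm, hrel⟩ := hq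
  have hdir : dx = dx' := hadm.1
  subst hdir
  have hw0 : 0 ≤ tpar i ⟨x, dx⟩ ⟨x', dx⟩ ^ (-ε) := Real.rpow_nonneg (tpar_nonneg i _ _) _
  by_cases hμ : dx = μ
  swap
  · -- another direction: `J_μλ` vanishes at both bonds
    have h1 : J lam (⟨x, dx⟩, s) = 0 := JcoKH_apply_of_dir_ne i b B cfg μ U₁ lam (p := (⟨x, dx⟩, s)) hμ
    have h2 : J lam (⟨x', dx⟩, s) = 0 := JcoKH_apply_of_dir_ne i b B cfg μ U₁ lam (p := (⟨x', dx⟩, s)) hμ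
    simp only [restrK, h1, h2, ite_self, sub_zero, abs_zero, mul_zero]
    exact hM0
  subst hμ
  by_cases hxx : x = x'
  · subst hxx
    rw [sub_self, abs_zero, mul_zero]
    exact hM0
  -- the read sites
  set z : SiteY i := chartY i (x.shift dx) with hz
  set z' : SiteY i := chartY i (x'.shift dx) with hz'
  have hrK : restrK i bI y (J lam) (⟨x, dx⟩, s) = J lam (⟨x, dx⟩, s) := if_pos hrel
  rw [hrK]
  by_cases hrel' : RelB i (bI ⟨x', dx⟩) y
  · -- (A) the partner lies in the class of `y`
    have hrK' : restrK i bI y (J lam) (⟨x', dx⟩, s) = J lam (⟨x', dx⟩, s) := if_pos hrel'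
    rw [hrK']
    have hD := abs_JcoKH_sub_le i b B cfg dx U₁ hU lam x x' s
    have hΘ' := hΘ dx x x' hadm
    have hzz : z ≠ z' := fun h => hxx (shift_injective' i ((chartY i).injective h))
    have hwS : tpar i ⟨x, dx⟩ ⟨x', dx⟩ ^ (-ε) ≤ wS i ε z z' := tpar_rpow_neg_le_wS_shift i hε hxx dx dx
    have hdiff : ∀ a, tpar i ⟨x, dx⟩ ⟨x', dx⟩ ^ (-ε) * |lam (z, s.1, a, s.2.2) - lam (z', s.1, a, s.2.2)| ≤ H := by
      intro a
      calc tpar i ⟨x, dx⟩ ⟨x', dx⟩ ^ (-ε) * |lam (z, s.1, a, s.2.2) - lam (z', s.1, a, s.2.2)|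
          ≤ wS i ε z z' * |lam (z, s.1, a, s.2.2) - lam (z', s.1, a, s.2.2)| := mul_le_mul_of_nonneg_right hwS (abs_nonneg _)
        _ = wS i ε z z' * |lam (z', (s.1, a, s.2.2)) - lam (z, (s.1, a, s.2.2))| := by rw [abs_sub_comm]
        _ ≤ H := wS_mul_abs_sub_le_holS i hloc ε hzz (s.1, a, s.2.2)
    have hsumS := sum_abs_le_card_mul_supS i hloc z s.1 s.2.2
    calc tpar i ⟨x, dx⟩ ⟨x', dx⟩ ^ (-ε) * |J lam (⟨x, dx⟩, s) - J lam (⟨x', dx⟩, s)|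
        ≤ tpar i ⟨x, dx⟩ ⟨x', dx⟩ ^ (-ε) * (coordBound39 b * (2 * ‖(cfg U₁ dx x : 𝔸) - (cfg U₁ dx x' : 𝔸)‖ *
            (basisBound39 b * ∑ a, |lam (z, s.1, a, s.2.2)|) + basisBound39 b * ∑ a, |lam (z, s.1, a, s.2.2) - lam (z', s.1, a, s.2.2)|)) :=
          mul_le_mul_of_nonneg_left hD hw0
      _ = coordBound39 b * (2 * (tpar i ⟨x, dx⟩ ⟨x', dx⟩ ^ (-ε) * ‖(cfg U₁ dx x : 𝔸) - (cfg U₁ dx x' : 𝔸)‖) *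
            (basisBound39 b * ∑ a, |lam (z, s.1, a, s.2.2)|) +
            basisBound39 b * ∑ a, tpar i ⟨x, dx⟩ ⟨x', dx⟩ ^ (-ε) * |lam (z, s.1, a, s.2.2) - lam (z', s.1, a, s.2.2)|) := by
          rw [← Finset.mul_sum]; ring
      _ ≤ coordBound39 b * (2 * ϑ * (basisBound39 b * ((Fintype.card κ : ℝ) * S)) + basisBound39 b * ∑ _a : κ, H) := by
          refine mul_le_mul_of_nonneg_left (add_le_add ?_ ?_) hcb
          · exact mul_le_mul (mul_le_mul_of_nonneg_left hΘ' (by norm_num)) (mul_le_mul_of_nonneg_left hsumS hbb)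
              (by positivity) (by positivity)
          · exact mul_le_mul_of_nonneg_left (Finset.sum_le_sum fun a _ => hdiff a) hbb
      _ = cR39 b * (2 * ϑ * S + H) := by
          rw [Finset.sum_const, Finset.card_univ, nsmul_eq_mul]; simp only [cR39]; ring
      _ ≤ cR39 b * (2 * ϑ * S + 2 * H) := hM1
  · -- (B) the partner lies outside the class of `y`: the jump `|J_μλ(b)|`
    have hrK' : restrK i bI y (J lam) (⟨x', dx⟩, s) = 0 := if_neg hrel'
    rw [hrK', sub_zero]
    by_cases hzy : RelB i (sIK i bI z) y'
    swap
    · rw [JcoKH_apply_eq_zero_of_off i b B cfg dx U₁ hU hloc (p := (⟨x, dx⟩, s)) hzy, abs_zero, mul_zero]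
      exact hM0
    -- a partner site among {x, x′} outside the class of `y′`, within `2|x − x′|` of the read site
    have hsx : sIK i bI (chartY i x) = bI ⟨x, dx⟩ := by rw [sIK_chartY, ← hbI0 ⟨x, dx⟩]
    have hsx' : sIK i bI (chartY i x') = bI ⟨x', dx⟩ := by rw [sIK_chartY, ← hbI0 ⟨x', dx⟩]
    obtain ⟨hd1, hd2⟩ := supDist_shift_partner_le i hxx dx
    have key : ∃ w₀ : Site (PV d ℓ i.m i.K hd hL) 0, ¬ RelB i (sIK i bI (chartY i w₀)) y' ∧
        (supDist (x.shift dx) w₀ : ℝ) ≤ 2 * (supDist x x' : ℝ) := by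
      by_cases hxy' : RelB i (bI ⟨x, dx⟩) y'
      · refine ⟨x', ?_, hd2⟩
        rw [hsx']
        intro h'
        exact hrel' (Eq.trans (Eq.trans h' (Eq.symm hxy')) hrel)
      · exact ⟨x, by rw [hsx]; exact hxy', hd1⟩
    obtain ⟨w₀, hw₀, hd₀⟩ := key
    have hne₀ : x.shift dx ≠ w₀ := fun h => hw₀ (by rw [← h]; exact hzy)
    have hzne : z ≠ chartY i w₀ := fun h => hne₀ ((chartY i).injective h)
    have hw2 : tpar i ⟨x, dx⟩ ⟨x', dx⟩ ^ (-ε) ≤ 2 * wS i ε z (chartY i w₀) := tpar_rpow_neg_le_two_mul_wS i hε hε1 hxx dx hne₀ hd₀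
    have hjump : ∀ a, tpar i ⟨x, dx⟩ ⟨x', dx⟩ ^ (-ε) * |lam (z, s.1, a, s.2.2)| ≤ 2 * H := by
      intro a
      calc tpar i ⟨x, dx⟩ ⟨x', dx⟩ ^ (-ε) * |lam (z, s.1, a, s.2.2)| ≤ (2 * wS i ε z (chartY i w₀)) * |lam (z, s.1, a, s.2.2)| :=
            mul_le_mul_of_nonneg_right hw2 (abs_nonneg _)
        _ = 2 * (wS i ε z (chartY i w₀) * |lam (z, (s.1, a, s.2.2))|) := by ring
        _ ≤ 2 * H := mul_le_mul_of_nonneg_left (wS_mul_abs_le_holS_of_off i hloc ε hzne hw₀ (s.1, a, s.2.2)) (by norm_num)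
    calc tpar i ⟨x, dx⟩ ⟨x', dx⟩ ^ (-ε) * |J lam (⟨x, dx⟩, s)|
        ≤ tpar i ⟨x, dx⟩ ⟨x', dx⟩ ^ (-ε) * (coordBound39 b * (basisBound39 b * ∑ a, |lam (z, s.1, a, s.2.2)|)) :=
          mul_le_mul_of_nonneg_left (abs_JcoKH_apply_le i b B cfg dx U₁ hU lam (⟨x, dx⟩, s)) hw0
      _ = coordBound39 b * (basisBound39 b * ∑ a, tpar i ⟨x, dx⟩ ⟨x', dx⟩ ^ (-ε) * |lam (z, s.1, a, s.2.2)|) := by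
          rw [← Finset.mul_sum]; ring
      _ ≤ coordBound39 b * (basisBound39 b * ∑ _a : κ, 2 * H) :=
          mul_le_mul_of_nonneg_left (mul_le_mul_of_nonneg_left (Finset.sum_le_sum fun a _ => hjump a) hbb) hcb
      _ = cR39 b * (2 * H) := by rw [Finset.sum_const, Finset.card_univ, nsmul_eq_mul]; simp only [cR39]; ring
      _ ≤ cR39 b * (2 * ϑ * S + 2 * H) := hM2

variable [Fintype (geo9K i).Site]

/-- ★★ **THE HÖLDER MAJORANT OF THE KINEMATIC LETTER `J_μ(U)` BETWEEN THE FLAT INPUT NORMS, UNDER THE SMALL-FIELD-GAUGE BINDER** — from n06-d's site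
input class `bHS (sIK bI) ε` (`|λ| + ‖λ‖_ε` on the class, η-scale weight) to the bond input class `bHK bI ε` (`|A| + ‖A‖^ξ_ε`), for `bI` 1-faithful (`hβ1`) and
direction-blind (`hbI0`), contracting link variables (`hU`, every `SU(N)`-valued `U`), `0 ≤ ε ≤ 1`, and THE BINDER `hΘ`: the ξ-scale ε-Hölder datum of the link
field, `t(b,b′)^{−ε}·‖U_μ(b₋) − U_μ(b′₋)‖ ≤ ϑ` on admissible same-direction pairs — what (3.35) provides INSIDE one cube's small-field gauge (`U = e^{iηA}`,
`|∇^ηA| < cMα₀(Lʲη)⁻²` ⇒ `ϑ = O((d+1)·cMα₀·L^{−j})`); the flat norms are gauge-VARIANT and `hΘ` is NOT a consequence of `Reg335` in a general global gauge —: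
`HasMaj (bHS (sIK bI) ε) (bHK bI ε) (J_μ(U)) (2(1+ϑ)·cR39 b·e^{δ·rJ}·e^{−δd})`, every `δ ≥ 0` (`rJ = (d+1)(L+1)+2`: the value of `J_μλ` at `p` reads `λ`
only at `chart(p₋ + e_μ)`, within `rJ` of the class of `p`).  Proof: sup part `≤ cR39·|λ|` (p612121); Hölder part `holK_JcoKH_le`.
[cite: Balaban1985BackgroundPropagators, (3.3) p.390 + (3.35) p.396 + (3.39)–(3.41) p.397 + (3.44) p.398 + p.398 («invariant with respect to gauge transformations»); Balaban1984PropagatorsII, (2.45)–(2.46) p.231 + (2.51)–(2.52) p.232 + (2.137) p.247] -/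
theorem hasMaj_JcoKH_holder
    (hβ1 : ∀ f : FBondY i, (geomT i.D).dist (β i.hN i.D i.hk (bI f)) (blkV1 i.hN i.D f) ≤ 1)
    (hbI0 : ∀ f : FBondY i, bI f = bI ⟨f.src, 0⟩) {U₁ : B.Cfg}
    (hU : ∀ (ν : Fin (d + 1)) (s : Site (PV d ℓ i.m i.K hd hL) 0), ‖(cfg U₁ ν s : 𝔸)‖ ≤ 1 ∧ ‖(((cfg U₁ ν s)⁻¹ : 𝔸ˣ) : 𝔸)‖ ≤ 1)
    {ε : ℝ} (hε : 0 ≤ ε) (hε1 : ε ≤ 1) {ϑ : ℝ} (hϑ : 0 ≤ ϑ)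
    (hΘ : ∀ (μ : Fin (d + 1)) (s s' : Site (PV d ℓ i.m i.K hd hL) 0), Adm i ⟨s, μ⟩ ⟨s', μ⟩ →
      tpar i ⟨s, μ⟩ ⟨s', μ⟩ ^ (-ε) * ‖(cfg U₁ μ s : 𝔸) - (cfg U₁ μ s' : 𝔸)‖ ≤ ϑ)
    {δ : ℝ} (hδ : 0 ≤ δ) {R₀ : ℝ} {H₀ : Prop} (μ : Fin (d + 1)) :
    HasMaj (bHS (R := R₀) (H := H₀) i (sIK i bI) ε) (bHK (R := R₀) (H := H₀) i bI ε) (JcoKH i b B cfg μ U₁)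
      (fun a a' => 2 * (1 + ϑ) * cR39 b * Real.exp (δ * rJ d ℓ) * Real.exp (-(δ * (geo9K i).dist a a'))) := by
  intro y' lam hloc y
  have hloc' : ∀ p : XSK κ i, ¬ RelB i (sIK i bI p.1) y' → lam p = 0 := hloc
  set J := JcoKH i b B cfg μ U₁ with hJ
  set S : ℝ := supS i (sIK i bI) y' lam with hS
  set H : ℝ := holS i (sIK i bI) ε y' lam with hH
  have hS0 : 0 ≤ S := supS_nonneg i _ y' lam
  have hH0 : 0 ≤ H := holS_nonneg i _ ε y' lam
  have hcR := cR39_nonneg b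
  have hcb : 0 ≤ coordBound39 b := norm_nonneg _
  have hbb : 0 ≤ basisBound39 b := Finset.sum_nonneg fun _ _ => norm_nonneg _
  have hE1 := Real.exp_nonneg (δ * rJ d ℓ)
  have hE2 := Real.exp_nonneg (-(δ * (geo9K i).dist y y'))
  show supK i bI y (J lam) + holK i bI ε y (J lam) ≤
    2 * (1 + ϑ) * cR39 b * Real.exp (δ * rJ d ℓ) * Real.exp (-(δ * (geo9K i).dist y y')) * (S + H)
  have hval : ∀ p : XBK κ i, |J lam p| ≤ cR39 b * S := by
    intro p
    refine (abs_JcoKH_apply_le i b B cfg μ U₁ hU lam p).trans ?_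
    calc coordBound39 b * (basisBound39 b * ∑ a, |lam (chartY i (p.1.src.shift μ), p.2.1, a, p.2.2.2)|)
        ≤ coordBound39 b * (basisBound39 b * ((Fintype.card κ : ℝ) * S)) :=
          mul_le_mul_of_nonneg_left (mul_le_mul_of_nonneg_left (sum_abs_le_card_mul_supS i hloc' _ p.2.1 p.2.2.2) hbb) hcb
      _ = cR39 b * S := by simp only [cR39]; ring
  by_cases hex : ∃ p : XBK κ i, RelB i (bI p.1) y ∧ J lam p ≠ 0
  swap
  · -- nothing of `J_μλ` is seen from the class of `y`
    have hfar : ∀ p : XBK κ i, RelB i (bI p.1) y → J lam p = 0 := fun p hp => by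
      by_contra h
      exact hex ⟨p, hp, h⟩
    have hres : restrK i bI y (J lam) = 0 := by
      funext p
      by_cases hp : RelB i (bI p.1) y
      · simp [restrK, hp, hfar p hp]
      · simp [restrK, hp]
    have h0 : supK i bI y (J lam) + holK i bI ε y (J lam) = 0 := by
      simp only [supK, holK, hres, Pi.zero_apply, abs_zero, sub_zero, mul_zero, ite_self, Real.iSup_const_zero, add_zero]
    rw [h0]
    positivity
  · -- some bond of the class of `y` reads a site of the class of `y′`: the two classes are within `rJ`
    obtain ⟨p₀, hp₀y, hp₀⟩ := hex
    have hz₀ : RelB i (sIK i bI (chartY i (p₀.1.src.shift μ))) y' := by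
      by_contra h
      exact hp₀ (JcoKH_apply_eq_zero_of_off i b B cfg μ U₁ hU hloc' h)
    have hdist : (geo9K i).dist y y' ≤ rJ d ℓ := by
      have e1 : β i.hN i.D i.hk (bI p₀.1) = β i.hN i.D i.hk y := hp₀y
      have e2 : β i.hN i.D i.hk (sIK i bI (chartY i (p₀.1.src.shift μ))) = β i.hN i.D i.hk y' := hz₀
      show (geomT i.D).dist (β i.hN i.D i.hk y) (β i.hN i.D i.hk y') ≤ rJ d ℓ
      rw [← e1, ← e2]
      exact dist_bI_sIK_shift_le i hβ1 p₀.1.src μ p₀.1.dir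
    have hK : 2 * (1 + ϑ) * cR39 b ≤ 2 * (1 + ϑ) * cR39 b * Real.exp (δ * rJ d ℓ) * Real.exp (-(δ * (geo9K i).dist y y')) := by
      have h1 : 1 ≤ Real.exp (δ * rJ d ℓ) * Real.exp (-(δ * (geo9K i).dist y y')) := by
        rw [← Real.exp_add]
        exact Real.one_le_exp (by nlinarith [mul_le_mul_of_nonneg_left hdist hδ])
      have h2 : 0 ≤ 2 * (1 + ϑ) * cR39 b := by positivity
      calc 2 * (1 + ϑ) * cR39 b = 2 * (1 + ϑ) * cR39 b * 1 := (mul_one _).symm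
        _ ≤ 2 * (1 + ϑ) * cR39 b * (Real.exp (δ * rJ d ℓ) * Real.exp (-(δ * (geo9K i).dist y y'))) := mul_le_mul_of_nonneg_left h1 h2
        _ = _ := by ring
    have hsup : supK i bI y (J lam) ≤ cR39 b * S := by
      refine Real.iSup_le (fun p => ?_) (mul_nonneg hcR hS0)
      by_cases hp : RelB i (bI p.1) y
      · simp only [restrK, if_pos hp]; exact hval p
      · simp only [restrK, if_neg hp, abs_zero]; exact mul_nonneg hcR hS0
    have hhol : holK i bI ε y (J lam) ≤ cR39 b * (2 * ϑ * S + 2 * H) := holK_JcoKH_le i b B cfg hbI0 hU hε hε1 hϑ hΘ μ hloc' y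
    calc supK i bI y (J lam) + holK i bI ε y (J lam) ≤ cR39 b * S + cR39 b * (2 * ϑ * S + 2 * H) := add_le_add hsup hhol
      _ = cR39 b * ((1 + 2 * ϑ) * S + 2 * H) := by ring
      _ ≤ 2 * (1 + ϑ) * cR39 b * (S + H) := by nlinarith [mul_nonneg hcR hS0, mul_nonneg hcR hH0, mul_nonneg (mul_nonneg hcR hϑ) hH0]
      _ ≤ 2 * (1 + ϑ) * cR39 b * Real.exp (δ * rJ d ℓ) * Real.exp (-(δ * (geo9K i).dist y y')) * (S + H) :=
          mul_le_mul_of_nonneg_right hK (add_nonneg hS0 hH0)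

end Holder

/-! ## §2 The two consumer currencies: length-re-weighted classes ([4] (2.60); p. 398) -/

section HolderWeight

open B9RWSums343to347Whole (Facts347)

variable (b : Module.Basis κ ℝ 𝔸) [FiniteDimensional ℝ 𝔸] (B : B9.Backgrounds) (cfg : B.Cfg → CfgY 𝔸 i)
variable [Fintype (geo9K i).Site] [DecidableRel (RelB i)] {bI : FBondY i → IBondY i}

/-- ★ **`J_μ(U)` IN THE 𝔥^{(γ)} CURRENCY**: the Hölder letter between the length-re-weighted input classes `weightNorm (bHS ε) len^γ → weightNorm (bHK ε) len^γ` (at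
`γ = −1` the source class of `Letters313DZ.dgDH ∕ Letters313DMZ.dgDHd` read from the 𝔠⁽¹⁾-type Hölder class), constant `2(1+ϑ)·cR39·e^{δ·rJ}·L^{|γ|}`, rate
`δ − αδ′`. [cite: Balaban1985BackgroundPropagators, (3.3) p.390 + (3.40) p.397 + p.398 (remark after (3.47)); Balaban1984PropagatorsII, Lemma 2.1 (2.60) p.234] -/
theorem hasMaj_JcoKH_holder_weight (hG : GeoOK (geo9K i)) {R₀ : ℝ} {H₀ : Prop} {dF : ℕ} {δ' α L₀ : ℝ} (hF : Facts347 (geo9K i) R₀ H₀ dF δ' α L₀)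
    (hβ1 : ∀ f : FBondY i, (geomT i.D).dist (β i.hN i.D i.hk (bI f)) (blkV1 i.hN i.D f) ≤ 1)
    (hbI0 : ∀ f : FBondY i, bI f = bI ⟨f.src, 0⟩) {U₁ : B.Cfg}
    (hU : ∀ (ν : Fin (d + 1)) (s : Site (PV d ℓ i.m i.K hd hL) 0), ‖(cfg U₁ ν s : 𝔸)‖ ≤ 1 ∧ ‖(((cfg U₁ ν s)⁻¹ : 𝔸ˣ) : 𝔸)‖ ≤ 1)
    {ε : ℝ} (hε : 0 ≤ ε) (hε1 : ε ≤ 1) {ϑ : ℝ} (hϑ : 0 ≤ ϑ)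
    (hΘ : ∀ (μ : Fin (d + 1)) (s s' : Site (PV d ℓ i.m i.K hd hL) 0), Adm i ⟨s, μ⟩ ⟨s', μ⟩ →
      tpar i ⟨s, μ⟩ ⟨s', μ⟩ ^ (-ε) * ‖(cfg U₁ μ s : 𝔸) - (cfg U₁ μ s' : 𝔸)‖ ≤ ϑ)
    {δ : ℝ} (hδ : 0 ≤ δ) (γ : ℝ) (hγ : |γ| ≤ 4) (μ : Fin (d + 1)) :
    HasMaj (weightNorm (bHS (R := R₀) (H := H₀) i (sIK i bI) ε) (fun y => (geo9K i).len y ^ γ) fun y => Real.rpow_nonneg (hG.lenle y) γ)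
      (weightNorm (bHK (R := R₀) (H := H₀) i bI ε) (fun y => (geo9K i).len y ^ γ) fun y => Real.rpow_nonneg (hG.lenle y) γ)
      (JcoKH i b B cfg μ U₁)
      (fun a a' => 2 * (1 + ϑ) * cR39 b * Real.exp (δ * rJ d ℓ) * (geo9K i).L ^ |γ| * Real.exp (-((δ - α * δ') * (geo9K i).dist a a'))) :=
  hasMaj_weight_len_rpow hG hF γ hγ (by have := cR39_nonneg b; positivity) (hasMaj_JcoKH_holder i b B cfg hβ1 hbI0 hU hε hε1 hϑ hΘ hδ μ)

/-- ★ **`J_μ(U)` FROM THE LENGTH-WEIGHTED SITE HÖLDER CLASS INTO THE BOND INPUT CLASS, KERNEL `C_J·(Lʲη)(a)·e^{−δ_J d}`** — the shape of the `hJ` binder of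
n06-w6's `B9Thm33G0DirXHolderFromDds` at `bH := weightNorm (bHS (sIK bI) ε) len⁻¹`, `bHX ε := bHK bI ε`: `C_J = 2(1+ϑ)·cR39·e^{δ·rJ}·L`, `δ_J = δ − αδ′`.
[cite: Balaban1985BackgroundPropagators, (3.3) p.390 + (3.40) p.397 + (3.45) p.398 + p.398 (remark after (3.47)); Balaban1984PropagatorsII, Lemma 2.1 (2.60) p.234] -/
theorem hasMaj_JcoKH_holder_len (hG : GeoOK (geo9K i)) {R₀ : ℝ} {H₀ : Prop} {dF : ℕ} {δ' α L₀ : ℝ} (hF : Facts347 (geo9K i) R₀ H₀ dF δ' α L₀)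
    (hβ1 : ∀ f : FBondY i, (geomT i.D).dist (β i.hN i.D i.hk (bI f)) (blkV1 i.hN i.D f) ≤ 1)
    (hbI0 : ∀ f : FBondY i, bI f = bI ⟨f.src, 0⟩) {U₁ : B.Cfg}
    (hU : ∀ (ν : Fin (d + 1)) (s : Site (PV d ℓ i.m i.K hd hL) 0), ‖(cfg U₁ ν s : 𝔸)‖ ≤ 1 ∧ ‖(((cfg U₁ ν s)⁻¹ : 𝔸ˣ) : 𝔸)‖ ≤ 1)
    {ε : ℝ} (hε : 0 ≤ ε) (hε1 : ε ≤ 1) {ϑ : ℝ} (hϑ : 0 ≤ ϑ)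
    (hΘ : ∀ (μ : Fin (d + 1)) (s s' : Site (PV d ℓ i.m i.K hd hL) 0), Adm i ⟨s, μ⟩ ⟨s', μ⟩ →
      tpar i ⟨s, μ⟩ ⟨s', μ⟩ ^ (-ε) * ‖(cfg U₁ μ s : 𝔸) - (cfg U₁ μ s' : 𝔸)‖ ≤ ϑ)
    {δ : ℝ} (hδ : 0 ≤ δ) (μ : Fin (d + 1)) :
    HasMaj (weightNorm (bHS (R := R₀) (H := H₀) i (sIK i bI) ε) (fun y => ((geo9K i).len y)⁻¹) fun y => inv_nonneg.2 (hG.lenle y))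
      (bHK (R := R₀) (H := H₀) i bI ε) (JcoKH i b B cfg μ U₁)
      (fun a a' => 2 * (1 + ϑ) * cR39 b * Real.exp (δ * rJ d ℓ) * (geo9K i).L * (geo9K i).len a *
        Real.exp (-((δ - α * δ') * (geo9K i).dist a a'))) :=
  hasMaj_weight_source_inv_len hG hF (by have := cR39_nonneg b; positivity) (hasMaj_JcoKH_holder i b B cfg hβ1 hbI0 hU hε hε1 hϑ hΘ hδ μ)

end HolderWeight

/-! ## §3 At node00-def-Y's members: every `Reg335` configuration has contracting link variables; the Hölder letter at the certificate's pins -/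

section Members

open scoped Matrix.Norms.L2Operator
open B7Prop2SpecialUnitary (specialUnitaryUnits)
open B9PinMembersKLevelV1 (MemberY geo9Y bg9Y)
open B9CoReadingCoordsTranspose (TrIdx trBasis)
open B9GradViaDivLettersAtPins (cfg_norm_le_one_of_reg335)

variable {Mstar : ℕ} {N : ℕ} [NeZero N]
variable [∀ x : MemberY d ℓ hd hL b₀ b₁ Mstar, Fintype (geo9Y x).Site] [∀ x : MemberY d ℓ hd hL b₀ b₁ Mstar, DecidableRel (RelB x.toKIdx)]

/-- ★★ **THE HÖLDER LETTER `J_μ(U)` AT THE CERTIFICATE'S PINS, EVERY MEMBER, EVERY REGULAR `U` IN SMALL-GAUGE POSITION**: at `JcoKH x.toKIdx (trBasis N) (bg9Y …)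
(fun U => U) μ U` between the pinned input classes `bHX x ε := bHS (sIK (bI x)) ε` and `bHXA x ε := bHK (bI x) ε` (`hbHX ∕ hbHXA`), `bI` 1-faithful (`hβ1`) and
direction-blind (`hbI0`), `U ∈ Reg335` (contracting links), and the small-field-gauge binder `hΘ` on `U`:
`HasMaj (bHS … ε) (bHK … ε) (J_μ(U)) (2(1+ϑ)·cR39 (trBasis N)·e^{δ·rJ}·e^{−δd})`, every `δ ≥ 0`, `0 ≤ ε ≤ 1`.
[cite: Balaban1985BackgroundPropagators, (3.3) p.390 + (3.35) p.396 + (3.39)–(3.41) p.397 + (3.44) p.398; Balaban1984PropagatorsII, (2.51)–(2.52) p.232 + (2.137) p.247] -/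
theorem hasMaj_JcoKH_holder_pins (x : MemberY d ℓ hd hL b₀ b₁ Mstar) {bI : FBondY x.toKIdx → IBondY x.toKIdx}
    (hβ1 : ∀ f : FBondY x.toKIdx, (geomT x.D).dist (β x.hN x.D x.hk (bI f)) (blkV1 x.hN x.D f) ≤ 1)
    (hbI0 : ∀ f : FBondY x.toKIdx, bI f = bI ⟨f.src, 0⟩) {c α₀ : ℝ}
    {U : (bg9Y (Matrix (Fin N) (Fin N) ℂ) (specialUnitaryUnits (Fin N)) x).Cfg}
    (hU : (bg9Y (Matrix (Fin N) (Fin N) ℂ) (specialUnitaryUnits (Fin N)) x).Reg335 c α₀ U)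
    {ε : ℝ} (hε : 0 ≤ ε) (hε1 : ε ≤ 1) {ϑ : ℝ} (hϑ : 0 ≤ ϑ)
    (hΘ : ∀ (μ : Fin (d + 1)) (s s' : Site (PV d ℓ x.toKIdx.m x.toKIdx.K hd hL) 0), Adm x.toKIdx ⟨s, μ⟩ ⟨s', μ⟩ →
      tpar x.toKIdx ⟨s, μ⟩ ⟨s', μ⟩ ^ (-ε) * ‖(U μ s : Matrix (Fin N) (Fin N) ℂ) - (U μ s' : Matrix (Fin N) (Fin N) ℂ)‖ ≤ ϑ)
    {δ : ℝ} (hδ : 0 ≤ δ) {R₀ : ℝ} {H₀ : Prop} (μ : Fin (d + 1)) :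
    letI : Fintype (geo9K x.toKIdx).Site := (inferInstance : Fintype (geo9Y x).Site)
    HasMaj (bHS (R := R₀) (H := H₀) x.toKIdx (sIK x.toKIdx bI) ε) (bHK (R := R₀) (H := H₀) x.toKIdx bI ε)
      (JcoKH x.toKIdx (trBasis N) (bg9Y (Matrix (Fin N) (Fin N) ℂ) (specialUnitaryUnits (Fin N)) x) (fun U => U) μ U)
      (fun a a' => 2 * (1 + ϑ) * cR39 (trBasis N) * Real.exp (δ * rJ d ℓ) * Real.exp (-(δ * (geo9Y x).dist a a'))) := by
  letI : Fintype (geo9K x.toKIdx).Site := (inferInstance : Fintype (geo9Y x).Site)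
  exact hasMaj_JcoKH_holder x.toKIdx (trBasis N) (bg9Y (Matrix (Fin N) (Fin N) ℂ) (specialUnitaryUnits (Fin N)) x) (fun U => U)
    hβ1 hbI0 (cfg_norm_le_one_of_reg335 x hU) hε hε1 hϑ hΘ hδ μ

end Members

end Literature.MathematicalPhysics.QuantumFieldTheory.Balaban1983to89.B9GradViaDivLettersAtPinsHolder

end
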